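import Literature.Analysis.Distribution.KernelScaling
import Literature.Analysis.FunctionSpaces.TranslationAverageApproxIdentity
import Mathlib.Analysis.Calculus.ParametricIntegral
import Mathlib.MeasureTheory.Integral.IntervalIntegral.IntegrationByParts
import Mathlib.MeasureTheory.Integral.IntervalIntegral.FundThmCalculus
import HarnessLib

/-!
# Pairing a tempered distribution with scaled kernels: derivatives in the scale, Taylor expansion

Topic `Literature/Analysis/Distribution`; sequel of `KernelScaling`. For a tempered distribution
`T ∈ 𝒮'(V)` on a finite-dimensional real inner product space, a Schwartz kernel `N` of compact
support and a test function `ψ`, consider the **regularised pairing** as a function of the scale,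

  `𝒜_{N,ψ}(w) = T(K_{N_w} ψ) = ∫ N_w(y) T(ψ(· − y)) dy`,  `N_w(y) = w^{-m} N(y/w)`

(`K_h = K_{id,h}` the averaging operator `u ↦ ∫ h(a) u(· − a) da` of `SchwartzTranslationAverage`;
the second form is the tree's exchange lemma). This file proves:

* `hasDerivAt_apply_translationAverage_scaleKernel` — **the scale derivative**: for `w > 0`,
  `𝒜_{N,ψ}'(w) = -∑ⱼ 𝒜_{Xⱼ N, ∂ⱼ ψ}(w)` (`Xⱼ N = ⟪·, bⱼ⟫ N`, `∂ⱼ = ∂_{bⱼ}` for an orthonormal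
  basis): differentiation under the integral sign using `∂_w N_w = -∑ⱼ ∂ⱼ((XⱼN)_w)`
  (`hasDerivAt_scaleKernel`), then the derivative is passed from the kernel to the test function
  inside the average (`translationAverage_id_lineDerivOp_kernel`); **no smoothness of
  `y ↦ T(ψ(· − y))` beyond continuity is used, and no negative power of `w` appears**;
* `scaledPairingSeq`, `hasDerivAt_scaledPairingSeq` — the iterated derivatives
  `𝒜^{(n)}_{N,ψ}(w) = (-1)ⁿ ∑_{J : Fin n → ι} 𝒜_{X_J N, ∂^J ψ}(w)` (`iterCoordMul`);
* `taylor_sum_add_integral_of_hasDerivAt` — Taylor's formula with the **integral remainder** for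
  an explicit sequence of successive derivatives on an open convex set (integration by parts), and
  its instance `apply_translationAverage_scaleKernel_eq_taylor`;
* `tendsto_apply_translationAverage_scaleKernel` — **approximate identity**: `𝒜_{N,ψ}(w) → T(ψ)`
  as `w → 0⁺` when `∫ N = 1` (`TranslationAverageApproxIdentity`).

These are the real-variable ingredients of the analytic deconvolution lemma
(`Literature/Analysis/Complex/AnalyticDeconvolution.lean`), by which the regularisation of the
Schwinger functions in Osterwalder–Schrader II (Comm. Math. Phys. 42 (1975), Ch. VI.1,
`T_k = S_k ∗ k_ρ`) is removed while keeping the bounds.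

## References

* L. Hörmander, *The Analysis of Linear Partial Differential Operators I* (1983), §1.3, §4.1
  (regularisation `u ∗ φ_ε → u`).
* K. Osterwalder, R. Schrader, *Axioms for Euclidean Green's functions II*, Comm. Math. Phys. 42
  (1975) 281–305, Ch. VI.1. [OsterwalderSchraderCMP1975]

Everything here is elementary and tagged folklore.
-/

noncomputable section

open MeasureTheory Filter Set Module SchwartzMap intervalIntegral
open scoped Topology RealInnerProductSpace LineDeriv Nat

namespace Literature.Analysis.Distribution

open Literature.Analysis.FunctionSpaces.SchwartzAverage

variable {V : Type*} [NormedAddCommGroup V] [InnerProductSpace ℝ V]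

/-! ### Iterated coordinate multiplication -/

/-- Iterated multiplication by the coordinates along a multi-index `J : Fin n → ι`:
`X_J N = ⟪·, b_{J 0}⟫ (X_{tail J} N)`. [folklore] -/
def iterCoordMul {ι : Type*} [Fintype ι] (b : OrthonormalBasis ι ℝ V) : {n : ℕ} → (Fin n → ι) → 𝓢(V, ℂ) → 𝓢(V, ℂ)
  | 0, _, N => N
  | _ + 1, J, N => coordMul (b (J 0)) (iterCoordMul b (Fin.tail J) N)

/-- Zero multi-index. [folklore] -/
@[simp]
theorem iterCoordMul_zero {ι : Type*} [Fintype ι] (b : OrthonormalBasis ι ℝ V) (J : Fin 0 → ι) (N : 𝓢(V, ℂ)) :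
    iterCoordMul b J N = N := rfl

/-- Successor multi-index. [folklore] -/
theorem iterCoordMul_succ {ι : Type*} [Fintype ι] (b : OrthonormalBasis ι ℝ V) {n : ℕ} (J : Fin (n + 1) → ι)
    (N : 𝓢(V, ℂ)) : iterCoordMul b J N = coordMul (b (J 0)) (iterCoordMul b (Fin.tail J) N) := rfl

/-- `X_{cons j J} N = X_j (X_J N)`. [folklore] -/
theorem iterCoordMul_cons {ι : Type*} [Fintype ι] (b : OrthonormalBasis ι ℝ V) {n : ℕ} (j : ι) (J : Fin n → ι)
    (N : 𝓢(V, ℂ)) : iterCoordMul b (Fin.cons j J) N = coordMul (b j) (iterCoordMul b J N) := by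
  rw [iterCoordMul_succ, Fin.cons_zero, Fin.tail_cons]

/-- Iterated coordinate multiplication does not enlarge the topological support. [folklore] -/
theorem tsupport_iterCoordMul_subset {ι : Type*} [Fintype ι] (b : OrthonormalBasis ι ℝ V) :
    ∀ {n : ℕ} (J : Fin n → ι) (N : 𝓢(V, ℂ)),
      tsupport (iterCoordMul b J N : V → ℂ) ⊆ tsupport (N : V → ℂ)
  | 0, _, _ => subset_rfl
  | _ + 1, J, N => (tsupport_coordMul_subset _ _).trans (tsupport_iterCoordMul_subset b (Fin.tail J) N)

/-! ### Two pointwise facts about scaled kernels, and the continuity of `y ↦ T(ψ(· − y))` -/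

/-- Continuity of `y ↦ T(ψ(· − y))`. [folklore] -/
theorem continuous_apply_compSubConstCLM_id (T : 𝓢(V, ℂ) →L[ℂ] ℂ) (ψ : 𝓢(V, ℂ)) :
    Continuous fun y : V => T (SchwartzMap.compSubConstCLM ℂ y ψ) := by
  simpa using continuous_apply_compSubConstCLM (ContinuousLinearMap.id ℝ V) T ψ

/-- A directional derivative of a scaled kernel vanishes away from the scaled support. [folklore] -/
theorem lineDerivOp_scaleKernel_eq_zero {R w : ℝ} (hw : 0 < w) {M : 𝓢(V, ℂ)}
    (hM : ∀ y, R < ‖y‖ → M y = 0) (v : V) {y : V} (hy : w * R < ‖y‖) :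
    (∂_{v} (scaleKernel w M)) y = 0 := by
  rw [SchwartzMap.lineDerivOp_apply_eq_fderiv]
  have hev : (⇑(scaleKernel w M) : V → ℂ) =ᶠ[𝓝 y] fun _ => 0 := by
    have ho : IsOpen {y : V | w * R < ‖y‖} := isOpen_lt continuous_const continuous_norm
    filter_upwards [ho.mem_nhds hy] with y' hy'
    exact scaleKernel_eq_zero hw hM hy'
  rw [hev.fderiv_eq]
  simp

/-- Uniform bound for the directional derivatives of a scaled kernel:
`|∂_v (M_w)(y)| ≤ w^{-m} w⁻¹ ‖v‖ p_{0,1}(M)`. [folklore] -/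
theorem norm_lineDerivOp_scaleKernel_le (M : 𝓢(V, ℂ)) {w : ℝ} (hw : 0 < w) (y v : V) :
    ‖(∂_{v} (scaleKernel w M)) y‖ ≤
      (w ^ finrank ℝ V)⁻¹ * w⁻¹ * (‖v‖ * SchwartzMap.seminorm ℂ 0 1 M) := by
  rw [lineDerivOp_scaleKernel_apply M hw.ne' y v, norm_smul, norm_smul, Real.norm_eq_abs,
    Real.norm_eq_abs, abs_of_pos (inv_pos.2 (pow_pos hw _)), abs_of_pos (inv_pos.2 hw), mul_assoc]
  refine mul_le_mul_of_nonneg_left (mul_le_mul_of_nonneg_left ?_ (inv_pos.2 hw).le)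
    (inv_pos.2 (pow_pos hw _)).le
  calc ‖fderiv ℝ M (w⁻¹ • y) v‖ ≤ ‖fderiv ℝ M (w⁻¹ • y)‖ * ‖v‖ := ContinuousLinearMap.le_opNorm _ _
    _ ≤ SchwartzMap.seminorm ℂ 0 1 M * ‖v‖ := by
        gcongr
        have h := SchwartzMap.le_seminorm ℂ 0 1 M (w⁻¹ • y)
        rw [pow_zero, one_mul, ← norm_iteratedFDeriv_fderiv, norm_iteratedFDeriv_zero] at h
        exact h
    _ = ‖v‖ * SchwartzMap.seminorm ℂ 0 1 M := mul_comm _ _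


/-! ### The regularised pairing as a parametric integral -/

variable [FiniteDimensional ℝ V] [MeasurableSpace V] [BorelSpace V]

local notation "Kavg" => translationAverage (ContinuousLinearMap.id ℝ V)


/-- **Exchange**: `T(K_{N_w} ψ) = ∫ N_w(y) T(ψ(· − y)) dy` (the tree's
`SchwartzAverage.integral_mul_apply_compSubConstCLM` with `A = id`). [folklore] -/
theorem apply_translationAverage_eq_integral (T : 𝓢(V, ℂ) →L[ℂ] ℂ) (h ψ : 𝓢(V, ℂ)) :
    T (Kavg h ψ) = ∫ y, h y * T (SchwartzMap.compSubConstCLM ℂ y ψ) := by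
  rw [← integral_mul_apply_compSubConstCLM (ContinuousLinearMap.id ℝ V) h T ψ]
  rfl

/-- **The scale derivative of the regularised pairing.** For `T ∈ 𝒮'(V)`, a kernel `N` supported
in `B̄(0, R)`, a test function `ψ`, an orthonormal basis `(bⱼ)` and `w₀ > 0`:
`d/dw|_{w₀} T(K_{N_w} ψ) = -∑ⱼ T(K_{(⟪·,bⱼ⟫N)_{w₀}} (∂_{bⱼ} ψ))`.
Proof: `T(K_{N_w} ψ) = ∫ N_w(y) T(ψ(· − y)) dy` (exchange), differentiate under the integral
(`∂_w N_w = -∑ⱼ ∂_{bⱼ}((XⱼN)_w)`, dominated on a compact ball since `y ↦ T(ψ(· − y))` is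
continuous), exchange back and pass `∂_{bⱼ}` from the kernel to `ψ`. [folklore] -/
theorem hasDerivAt_apply_translationAverage_scaleKernel {ι : Type*} [Fintype ι]
    (b : OrthonormalBasis ι ℝ V) (T : 𝓢(V, ℂ) →L[ℂ] ℂ) (N ψ : 𝓢(V, ℂ)) {R : ℝ}
    (hN : tsupport (N : V → ℂ) ⊆ Metric.closedBall 0 R) {w₀ : ℝ} (hw₀ : 0 < w₀) :
    HasDerivAt (fun w : ℝ => T (Kavg (scaleKernel w N) ψ))
      (-∑ j, T (Kavg (scaleKernel w₀ (coordMul (b j) N)) (∂_{b j} ψ))) w₀ := by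
  -- the continuous function `c(y) = T(ψ(· - y))`, bounded on the ball `B̄(0, 2 w₀ R)`
  set c : V → ℂ := fun y => T (SchwartzMap.compSubConstCLM ℂ y ψ) with hc
  have hc_cont : Continuous c := continuous_apply_compSubConstCLM_id T ψ
  obtain ⟨Mc₀, hMc₀⟩ := (isCompact_closedBall (0 : V) (2 * w₀ * R)).exists_bound_of_continuousOn
    hc_cont.continuousOn
  set Mc : ℝ := max Mc₀ 0 with hMc_def
  have hMc0 : 0 ≤ Mc := le_max_right _ _
  have hMc : ∀ y ∈ Metric.closedBall (0 : V) (2 * w₀ * R), ‖c y‖ ≤ Mc := fun y hy =>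
    (hMc₀ y hy).trans (le_max_left _ _)
  -- vanishing of the kernels outside their supports
  have hN0 : ∀ y, R < ‖y‖ → N y = 0 := eq_zero_of_tsupport_subset_closedBall hN
  have hXN0 : ∀ j y, R < ‖y‖ → coordMul (b j) N y = 0 := fun j => coordMul_eq_zero (b j) hN0
  -- the parametric integral and its derivative
  set m : ℕ := finrank ℝ V with hm
  set F : ℝ → V → ℂ := fun w y => scaleKernel w N y * c y with hF
  set F' : ℝ → V → ℂ := fun w y =>
    (-∑ j, (∂_{b j} (scaleKernel w (coordMul (b j) N))) y) * c y with hF'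
  have hrepr : (fun w : ℝ => T (Kavg (scaleKernel w N) ψ)) = fun w => ∫ y, F w y := by
    funext w
    exact apply_translationAverage_eq_integral T (scaleKernel w N) ψ
  -- constants for the domination on `w ∈ (w₀/2, 3w₀/2)`
  set S : ℝ := ∑ j, SchwartzMap.seminorm ℂ 0 1 (coordMul (b j) N) with hS
  have hS0 : 0 ≤ S := Finset.sum_nonneg fun j _ => apply_nonneg _ _
  set Cst : ℝ := ((w₀ / 2) ^ m)⁻¹ * (w₀ / 2)⁻¹ * S * Mc with hCst
  set bound : V → ℝ := (Metric.closedBall (0 : V) (2 * w₀ * R)).indicator fun _ => Cst with hbound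
  have hball : Metric.ball w₀ (w₀ / 2) ∈ 𝓝 w₀ := Metric.ball_mem_nhds _ (by positivity)
  have hwpos : ∀ w ∈ Metric.ball w₀ (w₀ / 2), w₀ / 2 < w ∧ w < 3 * w₀ / 2 := fun w hw => by
    rw [Metric.mem_ball, Real.dist_eq, abs_lt] at hw
    constructor <;> linarith
  have key := hasDerivAt_integral_of_dominated_loc_of_deriv_le (μ := volume) (F := F) (F' := F')
    (x₀ := w₀) (bound := bound) hball ?_ ?_ ?_ ?_ ?_ ?_
  · -- identify the derivative
    rw [hrepr]
    refine key.2.congr_deriv ?_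
    have hint : ∀ j, Integrable fun y : V =>
        (∂_{b j} (scaleKernel w₀ (coordMul (b j) N))) y * c y := fun j => by
      simpa using integrable_mul_apply_compSubConstCLM (ContinuousLinearMap.id ℝ V)
        (∂_{b j} (scaleKernel w₀ (coordMul (b j) N))) T ψ
    have hF'w₀ : (F' w₀) = fun y => -∑ j, (∂_{b j} (scaleKernel w₀ (coordMul (b j) N))) y * c y := by
      funext y
      simp only [hF', neg_mul, Finset.sum_mul]
    rw [hF'w₀, MeasureTheory.integral_neg, integral_finsetSum _ fun j _ => hint j]
    congr 1
    refine Finset.sum_congr rfl fun j _ => ?_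
    rw [← apply_translationAverage_eq_integral, translationAverage_id_lineDerivOp_kernel]
  · -- measurability of `F w`
    exact Eventually.of_forall fun w =>
      ((scaleKernel w N).continuous.mul hc_cont).aestronglyMeasurable
  · -- integrability of `F w₀`: continuous with compact support
    refine Continuous.integrable_of_hasCompactSupport ((scaleKernel w₀ N).continuous.mul hc_cont) ?_
    refine HasCompactSupport.intro (isCompact_closedBall (0 : V) (w₀ * R)) fun y hy => ?_
    rw [Metric.mem_closedBall, dist_zero_right, not_le] at hy
    simp only [hF, scaleKernel_eq_zero hw₀ hN0 hy, zero_mul]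
  · -- measurability of `F' w₀`
    refine Continuous.aestronglyMeasurable ?_
    refine Continuous.mul (Continuous.neg (continuous_finsetSum _ fun j _ => ?_)) hc_cont
    exact (∂_{b j} (scaleKernel w₀ (coordMul (b j) N))).continuous
  · -- domination
    refine Eventually.of_forall fun y w hw => ?_
    obtain ⟨hwlo, hwhi⟩ := hwpos w hw
    have hwpos' : 0 < w := lt_trans (by positivity) hwlo
    by_cases hy : y ∈ Metric.closedBall (0 : V) (2 * w₀ * R)
    · rw [hbound, indicator_of_mem hy, hF']
      simp only [neg_mul, norm_neg, norm_mul]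
      have h1 : ‖∑ j, (∂_{b j} (scaleKernel w (coordMul (b j) N))) y‖ ≤ (w ^ m)⁻¹ * w⁻¹ * S := by
        refine (norm_sum_le _ _).trans ?_
        rw [hS, Finset.mul_sum]
        refine Finset.sum_le_sum fun j _ => ?_
        have h := norm_lineDerivOp_scaleKernel_le (coordMul (b j) N) hwpos' y (b j)
        rwa [b.orthonormal.1 j, one_mul] at h
      have h2 : (w ^ m)⁻¹ * w⁻¹ * S ≤ ((w₀ / 2) ^ m)⁻¹ * (w₀ / 2)⁻¹ * S := by
        have hw2 : 0 < w₀ / 2 := by positivity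
        have ha : (w ^ m)⁻¹ ≤ ((w₀ / 2) ^ m)⁻¹ :=
          inv_anti₀ (pow_pos hw2 _) (pow_le_pow_left₀ hw2.le hwlo.le _)
        have hb : w⁻¹ ≤ (w₀ / 2)⁻¹ := inv_anti₀ hw2 hwlo.le
        exact mul_le_mul_of_nonneg_right (mul_le_mul ha hb (inv_pos.2 hwpos').le
          (inv_pos.2 (pow_pos hw2 _)).le) hS0
      calc ‖∑ j, (∂_{b j} (scaleKernel w (coordMul (b j) N))) y‖ * ‖c y‖
          ≤ (((w₀ / 2) ^ m)⁻¹ * (w₀ / 2)⁻¹ * S) * Mc :=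
            mul_le_mul (h1.trans h2) (hMc y hy) (norm_nonneg _) (by positivity)
        _ = Cst := by rw [hCst]
    · rw [hbound, indicator_of_notMem hy, hF']
      rw [Metric.mem_closedBall, dist_zero_right, not_le] at hy
      have hzero : ∀ j, (∂_{b j} (scaleKernel w (coordMul (b j) N))) y = 0 := fun j => by
        refine lineDerivOp_scaleKernel_eq_zero hwpos' (hXN0 j) (b j) ?_
        rcases le_or_gt 0 R with hR | hR
        · exact lt_of_le_of_lt (by nlinarith) hy
        · exact lt_of_lt_of_le (mul_neg_of_pos_of_neg hwpos' hR) (norm_nonneg y)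
      simp [hzero]
  · -- integrability of the bound
    rw [hbound]
    exact (integrableOn_const (C := Cst) (measure_closedBall_lt_top (x := (0 : V))
      (r := 2 * w₀ * R)).ne).integrable_indicator measurableSet_closedBall
  · -- pointwise derivative
    refine Eventually.of_forall fun y w hw => ?_
    have hwne : w ≠ 0 := (lt_trans (by positivity) (hwpos w hw).1).ne'
    have h := (hasDerivAt_scaleKernel b N y hwne).mul_const (c y)
    simpa only [hF'] using h

/-! ### Linearity in the kernel -/

omit [FiniteDimensional ℝ V] [MeasurableSpace V] [BorelSpace V] in
/-- `scaleKernel w` is additive in the kernel. [folklore] -/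
theorem scaleKernel_add (w : ℝ) (N₁ N₂ : 𝓢(V, ℂ)) :
    scaleKernel w (N₁ + N₂) = scaleKernel w N₁ + scaleKernel w N₂ := by
  by_cases hw : w = 0
  · simp [scaleKernel, hw]
  · simp [scaleKernel, hw, smul_add]

omit [FiniteDimensional ℝ V] [MeasurableSpace V] [BorelSpace V] in
/-- `scaleKernel w` of a finite sum. [folklore] -/
theorem scaleKernel_sum {α : Type*} (w : ℝ) (s : Finset α) (N : α → 𝓢(V, ℂ)) :
    scaleKernel w (∑ i ∈ s, N i) = ∑ i ∈ s, scaleKernel w (N i) := by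
  classical
  induction s using Finset.induction_on with
  | empty =>
    by_cases hw : w = 0 <;> simp [scaleKernel, hw]
  | insert a s ha ih => rw [Finset.sum_insert ha, Finset.sum_insert ha, scaleKernel_add, ih]

/-- The averaging operator is additive in the kernel. [folklore] -/
theorem translationAverage_id_add_kernel (h₁ h₂ u : 𝓢(V, ℂ)) :
    Kavg (h₁ + h₂) u = Kavg h₁ u + Kavg h₂ u := by
  ext x
  rw [add_apply, translationAverage_id_apply, translationAverage_id_apply, translationAverage_id_apply,
    ← integral_add (integrable_mul_comp_sub h₁ u x) (integrable_mul_comp_sub h₂ u x)]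
  refine integral_congr_ae (Eventually.of_forall fun a => ?_)
  simp [add_mul]

/-- The averaging operator of a finite sum of kernels. [folklore] -/
theorem translationAverage_id_sum_kernel {α : Type*} (s : Finset α) (h : α → 𝓢(V, ℂ)) (u : 𝓢(V, ℂ)) :
    Kavg (∑ i ∈ s, h i) u = ∑ i ∈ s, Kavg (h i) u := by
  classical
  induction s using Finset.induction_on with
  | empty =>
    ext x
    rw [Finset.sum_empty, Finset.sum_empty, translationAverage_id_apply]
    simp
  | insert a s ha ih => rw [Finset.sum_insert ha, Finset.sum_insert ha, translationAverage_id_add_kernel, ih]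

/-! ### Iterated scale derivatives -/

section Iterated

variable {ι : Type*} [Fintype ι]

/-- The **candidate `n`-th scale derivative** of the regularised pairing `w ↦ T(K_{N_w} ψ)`:
`𝒜⁽ⁿ⁾(w) = (-1)ⁿ ∑_{J : Fin n → ι} T(K_{(X_J N)_w} (∂^J ψ))`. [folklore] -/
def scaledPairingSeq (b : OrthonormalBasis ι ℝ V) (T : 𝓢(V, ℂ) →L[ℂ] ℂ) (N ψ : 𝓢(V, ℂ)) (n : ℕ)
    (w : ℝ) : ℂ :=
  (-1) ^ n * ∑ J : Fin n → ι, T (Kavg (scaleKernel w (iterCoordMul b J N)) (∂^{fun i => b (J i)} ψ))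

/-- The zeroth term is the regularised pairing itself. [folklore] -/
theorem scaledPairingSeq_zero (b : OrthonormalBasis ι ℝ V) (T : 𝓢(V, ℂ) →L[ℂ] ℂ) (N ψ : 𝓢(V, ℂ))
    (w : ℝ) : scaledPairingSeq b T N ψ 0 w = T (Kavg (scaleKernel w N) ψ) := by
  simp [scaledPairingSeq, LineDeriv.iteratedLineDerivOp_fin_zero]

/-- **Each candidate derivative is the derivative of the previous one** (`w₀ > 0`, `N` of compact
support): `d/dw 𝒜⁽ⁿ⁾ = 𝒜⁽ⁿ⁺¹⁾`. [folklore] -/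
theorem hasDerivAt_scaledPairingSeq (b : OrthonormalBasis ι ℝ V) (T : 𝓢(V, ℂ) →L[ℂ] ℂ)
    (N ψ : 𝓢(V, ℂ)) {R : ℝ} (hN : tsupport (N : V → ℂ) ⊆ Metric.closedBall 0 R) (n : ℕ) {w₀ : ℝ}
    (hw₀ : 0 < w₀) :
    HasDerivAt (scaledPairingSeq b T N ψ n) (scaledPairingSeq b T N ψ (n + 1) w₀) w₀ := by
  -- the summands and their derivatives
  set f : (Fin (n + 1) → ι) → ℂ := fun J' =>
    T (Kavg (scaleKernel w₀ (iterCoordMul b J' N)) (∂^{fun i => b (J' i)} ψ)) with hf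
  have h : ∀ J : Fin n → ι, HasDerivAt
      (fun w : ℝ => T (Kavg (scaleKernel w (iterCoordMul b J N)) (∂^{fun i => b (J i)} ψ)))
      (-∑ j, f (Fin.cons j J)) w₀ := by
    intro J
    exact hasDerivAt_apply_translationAverage_scaleKernel b T (iterCoordMul b J N)
      (∂^{fun i => b (J i)} ψ) ((tsupport_iterCoordMul_subset b J N).trans hN) hw₀
  have hsum : HasDerivAt (fun w : ℝ => ∑ J : Fin n → ι,
      T (Kavg (scaleKernel w (iterCoordMul b J N)) (∂^{fun i => b (J i)} ψ)))
      (∑ J : Fin n → ι, -∑ j, f (Fin.cons j J)) w₀ := HasDerivAt.fun_sum fun J _ => h J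
  have hmain := hsum.const_mul ((-1 : ℂ) ^ n)
  unfold scaledPairingSeq
  refine hmain.congr_deriv ?_
  -- reindex `Fin (n+1) → ι ≃ ι × (Fin n → ι)`
  have hre : ∑ J' : Fin (n + 1) → ι, f J' = ∑ J : Fin n → ι, ∑ j, f (Fin.cons j J) := by
    rw [Fintype.sum_equiv (Fin.consEquiv fun _ => ι).symm f (fun p : ι × (Fin n → ι) => f (Fin.cons p.1 p.2))
      (fun J' => by
        conv_lhs => rw [← (Fin.consEquiv fun _ => ι).apply_symm_apply J']
        rfl),
      Fintype.sum_prod_type, Finset.sum_comm]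
  rw [hre, Finset.sum_neg_distrib, pow_succ]
  ring

/-- Differentiability, hence continuity, of the candidate derivatives on `(0, ∞)`. [folklore] -/
theorem continuousOn_scaledPairingSeq (b : OrthonormalBasis ι ℝ V) (T : 𝓢(V, ℂ) →L[ℂ] ℂ)
    (N ψ : 𝓢(V, ℂ)) {R : ℝ} (hN : tsupport (N : V → ℂ) ⊆ Metric.closedBall 0 R) (n : ℕ) :
    ContinuousOn (scaledPairingSeq b T N ψ n) (Ioi 0) := fun _ hw =>
  (hasDerivAt_scaledPairingSeq b T N ψ hN n hw).continuousAt.continuousWithinAt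

end Iterated

/-! ### Taylor's formula with integral remainder for an explicit sequence of derivatives -/

omit [FiniteDimensional ℝ V] [MeasurableSpace V] [BorelSpace V] in
/-- **Taylor's formula with the integral remainder**, for a sequence `a 0, a 1, …` of functions on an
open convex set `s ⊆ ℝ` each of which is the derivative of the previous one:
`a₀(x) = ∑_{j ≤ M} (x − x₀)ʲ/j! · aⱼ(x₀) + ∫_{x₀}^{x} (x − t)ᴹ/M! · a_{M+1}(t) dt` (`x₀, x ∈ s`;
induction on `M`, integrating by parts). [folklore] -/
theorem taylor_sum_add_integral_of_hasDerivAt {a : ℕ → ℝ → ℂ} {s : Set ℝ} (hs : IsOpen s)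
    (hconv : Convex ℝ s) (hd : ∀ n, ∀ t ∈ s, HasDerivAt (a n) (a (n + 1) t) t) (M : ℕ) {x₀ x : ℝ}
    (hx₀ : x₀ ∈ s) (hx : x ∈ s) :
    a 0 x = ∑ j ∈ Finset.range (M + 1), ((x : ℂ) - x₀) ^ j / (j ! : ℂ) * a j x₀ +
      ∫ t in x₀..x, ((x : ℂ) - t) ^ M / (M ! : ℂ) * a (M + 1) t := by
  have _ := hs
  have hsub : uIcc x₀ x ⊆ s := hconv.ordConnected.uIcc_subset hx₀ hx
  have hcont : ∀ n, ContinuousOn (a n) (uIcc x₀ x) := fun n t ht =>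
    (hd n t (hsub ht)).continuousAt.continuousWithinAt
  have hint : ∀ n, IntervalIntegrable (a n) volume x₀ x := fun n => (hcont n).intervalIntegrable
  -- the coefficient functions `u_M(t) = -(x - t)^{M+1}/(M+1)!` and their derivatives
  have hpowderiv : ∀ (M : ℕ) (t : ℝ), HasDerivAt (fun t : ℝ => -(((x : ℂ) - t) ^ (M + 1)) / ((M + 1)! : ℂ))
      (((x : ℂ) - t) ^ M / (M ! : ℂ)) t := by
    intro M t
    have h1 : HasDerivAt (fun t : ℝ => (x : ℂ) - (t : ℂ)) (-1) t := by
      simpa using ((hasDerivAt_id t).ofReal_comp).const_sub (x : ℂ)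
    have h2 := (h1.pow (M + 1)).neg.div_const ((M + 1)! : ℂ)
    refine h2.congr_deriv ?_
    rw [Nat.factorial_succ]
    push_cast
    have hM : ((M ! : ℂ)) ≠ 0 := by exact_mod_cast (Nat.factorial_pos M).ne'
    have hM1 : ((M : ℂ) + 1) ≠ 0 := by exact_mod_cast Nat.succ_ne_zero M
    field_simp
  induction M with
  | zero =>
    simp only [zero_add, Finset.range_one, Finset.sum_singleton, pow_zero, Nat.factorial_zero,
      Nat.cast_one, div_one, one_mul]
    rw [integral_eq_sub_of_hasDerivAt (fun t ht => hd 0 t (hsub ht)) (hint 1)]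
    ring
  | succ M ih =>
    rw [Finset.sum_range_succ, ih, add_assoc]
    congr 1
    -- integration by parts
    have hparts := integral_mul_deriv_eq_deriv_mul (a := x₀) (b := x)
      (u := fun t : ℝ => -(((x : ℂ) - t) ^ (M + 1)) / ((M + 1)! : ℂ))
      (u' := fun t : ℝ => ((x : ℂ) - t) ^ M / (M ! : ℂ)) (v := a (M + 1)) (v' := a (M + 2))
      (fun t _ => hpowderiv M t) (fun t ht => hd (M + 1) t (hsub ht))
      ((Continuous.continuousOn (by fun_prop)).intervalIntegrable) (hint (M + 2))
    beta_reduce at hparts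
    have hneg : ∫ t in x₀..x, -(((x : ℂ) - t) ^ (M + 1)) / ((M + 1)! : ℂ) * a (M + 2) t =
        -∫ t in x₀..x, ((x : ℂ) - t) ^ (M + 1) / ((M + 1)! : ℂ) * a (M + 2) t := by
      rw [← intervalIntegral.integral_neg]
      congr 1
      funext t
      ring
    have h0 : (-(((x : ℂ) - (x : ℝ)) ^ (M + 1)) / ((M + 1)! : ℂ)) = 0 := by simp
    rw [hneg, h0, zero_mul, zero_sub] at hparts
    linear_combination hparts

/-! ### The Taylor expansion of the regularised pairing in the scale -/

section Taylor

variable {ι : Type*} [Fintype ι]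

/-- **Taylor expansion of `w ↦ T(K_{N_w} ψ)` about `w₀ > 0`** with the integral remainder through
the candidate derivatives `scaledPairingSeq` (`w > 0`). [folklore] -/
theorem apply_translationAverage_scaleKernel_eq_taylor (b : OrthonormalBasis ι ℝ V)
    (T : 𝓢(V, ℂ) →L[ℂ] ℂ) (N ψ : 𝓢(V, ℂ)) {R : ℝ}
    (hN : tsupport (N : V → ℂ) ⊆ Metric.closedBall 0 R) (M : ℕ) {w₀ w : ℝ} (hw₀ : 0 < w₀)
    (hw : 0 < w) :
    T (Kavg (scaleKernel w N) ψ) =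
      ∑ j ∈ Finset.range (M + 1), ((w : ℂ) - w₀) ^ j / (j ! : ℂ) * scaledPairingSeq b T N ψ j w₀ +
        ∫ t in w₀..w, ((w : ℂ) - t) ^ M / (M ! : ℂ) * scaledPairingSeq b T N ψ (M + 1) t := by
  rw [← scaledPairingSeq_zero b T N ψ w]
  exact taylor_sum_add_integral_of_hasDerivAt isOpen_Ioi (convex_Ioi 0)
    (fun n t ht => hasDerivAt_scaledPairingSeq b T N ψ hN n ht) M hw₀ hw

end Taylor

/-! ### Approximate identity -/

/-- **The scaled kernels are an approximate identity on `𝓢`**: for `∫ N = 1` and `N` of compact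
support, `K_{N_w} ψ → ψ` in the Schwartz topology as `w → 0⁺`
(`seminorm_translationAverage_sub_le` of `TranslationAverageApproxIdentity`, with `∫ ‖N_w‖ = ∫ ‖N‖`
and support radius `wR → 0`). [folklore] -/
theorem tendsto_translationAverage_scaleKernel (N ψ : 𝓢(V, ℂ)) {R : ℝ}
    (hN : tsupport (N : V → ℂ) ⊆ Metric.closedBall 0 R) (hmass : ∫ y, N y = 1) :
    Tendsto (fun w : ℝ => Kavg (scaleKernel w N) ψ) (𝓝[>] 0) (𝓝 ψ) := by
  rw [(schwartz_withSeminorms ℂ V ℂ).tendsto_nhds _ _]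
  rintro ⟨k, l⟩ ε hε
  set I : ℝ := ∫ y, ‖N y‖ with hI
  have hI0 : 0 ≤ I := integral_nonneg fun _ => norm_nonneg _
  obtain ⟨Rε, hRε, hω⟩ := exists_radius_seminorm_compSubConstCLM_sub_le (ContinuousLinearMap.id ℝ V)
    ψ k l (ε := ε / (2 * (I + 1))) (by positivity)
  have hδ : 0 < Rε / (|R| + 1) := by positivity
  filter_upwards [Ioo_mem_nhdsGT hδ] with w hw
  have hwpos : 0 < w := hw.1
  have hwR : w * R ≤ Rε := by
    have h1 : w * R ≤ w * |R| := mul_le_mul_of_nonneg_left (le_abs_self R) hwpos.le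
    have h2 : w * (|R| + 1) < Rε := (lt_div_iff₀ (by positivity)).1 hw.2
    nlinarith [abs_nonneg R]
  have hN0 := eq_zero_of_tsupport_subset_closedBall hN
  have hsupp : ∀ a, w * R < ‖a‖ → scaleKernel w N a = 0 := fun a ha => scaleKernel_eq_zero hwpos hN0 ha
  have hmassw : ∫ a, scaleKernel w N a = 1 := by rw [integral_scaleKernel hwpos, hmass]
  have hωw : ∀ a : V, ‖a‖ ≤ w * R →
      SchwartzMap.seminorm ℂ k l (SchwartzMap.compSubConstCLM ℂ ((ContinuousLinearMap.id ℝ V) a) ψ - ψ) ≤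
        ε / (2 * (I + 1)) := fun a ha => hω a (ha.trans hwR)
  have h := seminorm_translationAverage_sub_le (ContinuousLinearMap.id ℝ V) (scaleKernel w N) hmassw hsupp ψ
    k l (by positivity) hωw
  rw [integral_norm_scaleKernel hwpos] at h
  rw [schwartzSeminormFamily_apply]
  calc SchwartzMap.seminorm ℂ k l (Kavg (scaleKernel w N) ψ - ψ) ≤ I * (ε / (2 * (I + 1))) := h
    _ < ε := by
        rw [mul_div_assoc', div_lt_iff₀ (by positivity)]
        nlinarith

/-- **The regularised pairing tends to the pairing**: `T(K_{N_w} ψ) → T(ψ)` as `w → 0⁺`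
(`∫ N = 1`). [folklore] -/
theorem tendsto_apply_translationAverage_scaleKernel (T : 𝓢(V, ℂ) →L[ℂ] ℂ) (N ψ : 𝓢(V, ℂ)) {R : ℝ}
    (hN : tsupport (N : V → ℂ) ⊆ Metric.closedBall 0 R) (hmass : ∫ y, N y = 1) :
    Tendsto (fun w : ℝ => T (Kavg (scaleKernel w N) ψ)) (𝓝[>] 0) (𝓝 (T ψ)) :=
  (T.continuous.tendsto ψ).comp (tendsto_translationAverage_scaleKernel N ψ hN hmass)

end Literature.Analysis.Distribution
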